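import Mathlib
import Summits.ResolutionOfSingularities.ResolutionOfSingularities.Theorems.HomologicalConductorPersistenceFaithfullyFlatDescent
import Literature.RingTheory.CohomologyAnnihilator.Completion
import HarnessLib

set_option linter.dupNamespace false

/-!
# Faithfully flat descent of `caⁿ` without noetherianity upstairs; the completion case

`[OURS · L1 w44b · follow-up to ORDER w44b-o8b (res-L1-w44b-plan-1), res-type-015 gen 14]` —
helper for the surface rung `PersistenceSurface` (stmt-ResolutionOfSingularities-19970) of the crux
`HomologicalConductor.Persistence` (stmt-ResolutionOfSingularities-16484) and for the «C-comp»
transfer of crux chain W4.4 (`NoZeno` / `NoZenoR`).  NOT a statement of the manuscript under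
adjudication in cell res-hironaka; nothing here is attributed to its author.  Pure commutative
algebra over Mathlib and the tree's `Literature.RingTheory.CohomologyAnnihilator` library.

The sibling file `…PersistenceFaithfullyFlatDescent` (p509146) proves
`caⁿ⁺¹(S) ∩ T ⊆ caⁿ⁺¹(T)` for `S` faithfully flat over `T` with BOTH rings noetherian; the
noetherianity of `S` entered only through the forward direction of the reduction lemma CA1 over `S`.
Here that use is removed: an element of `caⁿ⁺¹(S)` stably annihilates every FINITELY PRESENTED `n`-th
syzygy over any commutative ring (`stablyAnnihilates_of_mem_of_isSyzygy_of_finitePresentation`), and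
the base change of a syzygy of a finitely generated module over noetherian `T` is finitely presented.
Hence:

* `comap_cohomologyAnnihilatorOfDegree_le_of_faithfullyFlat` — for `T` noetherian and `S` ANY
  faithfully flat `T`-algebra: `caⁿ(S) ∩ T ⊆ caⁿ(T)` for every `n` (degree `0` separately:
  `ca⁰ = ⊥` upstairs and `T → S` is injective); `comap_cohomologyAnnihilator_le_of_faithfullyFlat'`.
* `caCompletion_comap_le_holds` — the NAMED FACT
  `Literature.RingTheory.CohomologyAnnihilator.caCompletion_comap_le`
  ([BahlekehHakimianSalarianTakahashi2015, Theorem 4.5 (1)]: `caⁿ(R̂) ∩ R ⊆ caⁿ(R)` for every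
  noetherian local `R` and every `n`, `R̂ = AdicCompletion 𝔪 R`) is THEREBY PROVED: `R → R̂` is flat
  (Mathlib `AdicCompletion.flat_of_isNoetherian`), local (Mathlib's `IsLocalRing R̂` and
  `IsLocalHom (algebraMap R R̂)` instances), hence faithfully flat
  (`Module.FaithfullyFlat.of_flat_of_isLocalHom`) — no noetherianity of `R̂` is needed (the obstacle
  recorded in `Completion.lean`'s docstring is bypassed, not solved).  The conditional consequences
  in `Completion.lean` (`cohomologyAnnihilator_eq_comap_completion`, …) can now be fed
  `caCompletion_comap_le_holds` for their hypothesis `h₁`.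

## References

* A. Bahlekeh, E. Hakimian, S. Salarian, R. Takahashi, *Annihilation of cohomology, generation of
  modules and finiteness of derived dimension*, Q. J. Math. 67 (2016); arXiv:1503.03947 — Thm. 4.5 (1)
  («`R → R̂` is faithfully flat, hence pure»). [`BahlekehHakimianSalarianTakahashi2015`]
* S. B. Iyengar, R. Takahashi, *Annihilation of cohomology and strong generation of module
  categories*, IMRN 2016; arXiv:1404.1476 — §2, Remark 2.13. [`IyengarTakahashi2014`]
-/

noncomputable section

open CategoryTheory CategoryTheory.Abelian Literature.RingTheory.CohomologyAnnihilator
open Summit.ResolutionOfSingularities.ResolutionOfSingularities.Theorems.NoZeno.SandwichCluster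
open scoped TensorProduct

universe u

namespace Summit.ResolutionOfSingularities.ResolutionOfSingularities.Theorems.HomologicalConductor.PersistenceFaithfullyFlatDescentCompletion

open Summit.ResolutionOfSingularities.ResolutionOfSingularities.Theorems.HomologicalConductor.PersistenceFaithfullyFlatDescent

/-! ## CA1 forward without noetherianity, for finitely presented modules -/

/-- Over ANY commutative ring `S`: a finitely presented module `K` with `x • Ext¹(K, N) = 0` for
every finitely generated `N` is stably annihilated by `x` — for a finite free cover `P ↠ K` the
kernel is finitely generated (Mathlib `Module.FinitePresentation.fg_ker`), so the class of
`0 → ker → P → K → 0` is killed by `x` and `x • 𝟙 K` lifts to `P`.  (The tree's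
`stablyAnnihilates_of_forall_smul_ext_one_eq_zero` is the noetherian version.)
[cite: IyengarTakahashi2014, Remark 2.13] -/
theorem stablyAnnihilates_of_forall_smul_ext_one_eq_zero_of_finitePresentation {S : Type u}
    [CommRing S] {x : S} (K : ModuleCat.{u} S) [Module.FinitePresentation S K]
    (h : ∀ N : ModuleCat.{u} S, Module.Finite S N → ∀ e : Ext.{u} K N 1, x • e = 0) :
    StablyAnnihilates S x K := by
  obtain ⟨P, _, _, _, _, f, surjf⟩ := Module.exists_finite_presentation S K
  have hS := LinearMap.shortExact_shortComplexKer surjf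
  haveI : Module.Finite S (LinearMap.ker f) :=
    Module.Finite.iff_fg.mpr (Module.FinitePresentation.fg_ker f surjf)
  have hcl : x • hS.extClass = 0 := h (ModuleCat.of S (LinearMap.ker f)) inferInstance _
  obtain ⟨ψ, hψ⟩ := exists_comp_eq_smul_id_X₃_of_smul_extClass_eq_zero hS hcl
  exact ⟨ModuleCat.of S P, inferInstance, inferInstance, ψ, ModuleCat.ofHom f, hψ⟩

/-- **CA1, forward direction, without noetherianity**: over any commutative ring `S`, an element
`x ∈ caⁿ⁺¹(S)` stably annihilates every finitely presented `n`-th syzygy module `K` of a finitely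
generated module `M` (injective dimension shifting `Ext¹(K, N) ↪ Extⁿ⁺¹(M, N)`, tree
`ext_smul_eq_zero_of_isSyzygy`, then the previous lemma). [cite: IyengarTakahashi2014, Remark 2.3] -/
theorem stablyAnnihilates_of_mem_of_isSyzygy_of_finitePresentation {S : Type u} [CommRing S]
    {n : ℕ} {x : S} (hx : x ∈ cohomologyAnnihilatorOfDegree S (n + 1)) {M K : ModuleCat.{u} S}
    [Module.Finite S M] [Module.FinitePresentation S K] (hK : IsSyzygy n M K) :
    StablyAnnihilates S x K := by
  refine stablyAnnihilates_of_forall_smul_ext_one_eq_zero_of_finitePresentation K fun N hN e => ?_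
  haveI := hN
  refine ext_smul_eq_zero_of_isSyzygy n hK N 1 le_rfl x (fun e' => ?_) e
  exact smul_eq_zero_of_mem_cohomologyAnnihilatorOfDegree hx (i := 1 + n) (by omega) e'

/-! ## Faithfully flat descent of `caⁿ`, `S` arbitrary -/

/-- **`caⁿ⁺¹` descends along ANY faithfully flat algebra over a noetherian ring** (same index):
for `T` noetherian and `S` faithfully flat over `T` (not necessarily noetherian),
`caⁿ⁺¹(S) ∩ T ⊆ caⁿ⁺¹(T)`.  As in the sibling file: CA1 over `T`; for an `n`-th syzygy `K` of a
finitely generated `T`-module `M`, `S ⊗ K` is a finitely presented `n`-th syzygy of `S ⊗ M`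
(`IsSyzygy.baseChange`; `K` is finitely generated over noetherian `T`, hence finitely presented, and
finite presentation is stable under base change), so `algebraMap x` stably annihilates it
(`stablyAnnihilates_of_mem_of_isSyzygy_of_finitePresentation`), and (D1)
`StablyAnnihilates.of_faithfullyFlat_baseChange` descends. [folklore] -/
theorem comap_cohomologyAnnihilatorOfDegree_succ_le_of_faithfullyFlat' {T S : Type u} [CommRing T]
    [CommRing S] [Algebra T S] [IsNoetherianRing T] [Module.FaithfullyFlat T S] (n : ℕ) :
    (cohomologyAnnihilatorOfDegree S (n + 1)).comap (algebraMap T S) ≤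
      cohomologyAnnihilatorOfDegree T (n + 1) := by
  intro x hx
  rw [Ideal.mem_comap] at hx
  rw [mem_cohomologyAnnihilatorOfDegree_succ_iff_forall_isSyzygy]
  intro M K hM hK
  haveI := hM
  haveI : Module.Finite T K := finite_of_isSyzygy n hM hK
  haveI : Module.FinitePresentation T K := Module.finitePresentation_of_finite T K
  have hKS : IsSyzygy n (ModuleCat.of S (S ⊗[T] M)) (ModuleCat.of S (S ⊗[T] K)) :=
    IsSyzygy.baseChange S n hK
  have hS : StablyAnnihilates S (algebraMap T S x) (ModuleCat.of S (S ⊗[T] K)) :=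
    stablyAnnihilates_of_mem_of_isSyzygy_of_finitePresentation hx hKS
  exact StablyAnnihilates.of_faithfullyFlat_baseChange (S := S) x K hS

/-- **`caⁿ` descends along any faithfully flat algebra over a noetherian ring, every `n`**: degree
`n + 1` is the previous theorem; in degree `0`, `ca⁰(S) = ⊥` when `S` is nontrivial (tree
`cohomologyAnnihilatorOfDegree_zero`) and `T → S` is injective (`S` faithfully flat, Mathlib
`Module.FaithfullyFlat.faithfulSMul`), while a trivial `S` forces a trivial `T`. [folklore] -/
theorem comap_cohomologyAnnihilatorOfDegree_le_of_faithfullyFlat {T S : Type u} [CommRing T]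
    [CommRing S] [Algebra T S] [IsNoetherianRing T] [Module.FaithfullyFlat T S] (n : ℕ) :
    (cohomologyAnnihilatorOfDegree S n).comap (algebraMap T S) ≤ cohomologyAnnihilatorOfDegree T n := by
  cases n with
  | succ n => exact comap_cohomologyAnnihilatorOfDegree_succ_le_of_faithfullyFlat' n
  | zero =>
    intro x hx
    rw [Ideal.mem_comap] at hx
    have hinj := FaithfulSMul.algebraMap_injective T S
    rcases subsingleton_or_nontrivial S with hS | hS
    · haveI : Subsingleton T := hinj.subsingleton
      rw [Subsingleton.elim x 0]
      exact Ideal.zero_mem _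
    · rw [cohomologyAnnihilatorOfDegree_zero, Ideal.mem_bot] at hx
      rw [show x = 0 from hinj (by rw [hx, map_zero])]
      exact Ideal.zero_mem _

/-- **`ca` descends along any faithfully flat algebra over a noetherian ring**: `ca(S) ∩ T ⊆ ca(T)`
(no noetherianity of `S`). [folklore] -/
theorem comap_cohomologyAnnihilator_le_of_faithfullyFlat' {T S : Type u} [CommRing T] [CommRing S]
    [Algebra T S] [IsNoetherianRing T] [Module.FaithfullyFlat T S] :
    (cohomologyAnnihilator S).comap (algebraMap T S) ≤ cohomologyAnnihilator T := by
  intro x hx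
  rw [Ideal.mem_comap, mem_cohomologyAnnihilator_iff] at hx
  obtain ⟨n, hn⟩ := hx
  rw [mem_cohomologyAnnihilator_iff]
  exact ⟨n, comap_cohomologyAnnihilatorOfDegree_le_of_faithfullyFlat (S := S) n
    (Ideal.mem_comap.mpr hn)⟩

/-! ## The completion of a noetherian local ring -/

/-- The `𝔪`-adic completion of a noetherian local ring is FAITHFULLY FLAT over it: flat (Mathlib
`AdicCompletion.flat_of_isNoetherian`), local with local structure map (Mathlib's instances in
`RingTheory/AdicCompletion/LocalRing.lean`), and a flat local homomorphism of local rings is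
faithfully flat (Mathlib `Module.FaithfullyFlat.of_flat_of_isLocalHom`).
[cite: Matsumura1987, Theorem 8.14] -/
theorem faithfullyFlat_adicCompletion (R : Type u) [CommRing R] [IsNoetherianRing R]
    [IsLocalRing R] :
    Module.FaithfullyFlat R (AdicCompletion (IsLocalRing.maximalIdeal R) R) :=
  Module.FaithfullyFlat.of_flat_of_isLocalHom

/-- **[BahlekehHakimianSalarianTakahashi2015, Theorem 4.5 (1)] PROVED** — the named fact
`Literature.RingTheory.CohomologyAnnihilator.caCompletion_comap_le` holds: for every noetherian local
ring `R` and every `n`, `caⁿ(R̂) ∩ R ⊆ caⁿ(R)` (`R̂ = AdicCompletion 𝔪 R`).  By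
`comap_cohomologyAnnihilatorOfDegree_le_of_faithfullyFlat` applied to the faithfully flat map
`R → R̂` (`faithfullyFlat_adicCompletion`); the printed proof's «`R → R̂` is faithfully flat, hence
pure» is exactly the mechanism, with the base change of `Ext` replaced by the presentation criterion
for stable annihilation. [cite: BahlekehHakimianSalarianTakahashi2015, Theorem 4.5 (1)] -/
theorem caCompletion_comap_le_holds :
    Literature.RingTheory.CohomologyAnnihilator.caCompletion_comap_le.{u} := by
  intro R _ _ _ n
  haveI := faithfullyFlat_adicCompletion R
  exact comap_cohomologyAnnihilatorOfDegree_le_of_faithfullyFlat n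

end Summit.ResolutionOfSingularities.ResolutionOfSingularities.Theorems.HomologicalConductor.PersistenceFaithfullyFlatDescentCompletion

end
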